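import Summits.QuantumFields.YangMills.Theorems.UnitScaleTiltProp7CovPinnedKernelL1OfRowsCore
import Summits.QuantumFields.YangMills.Theorems.UnitScaleTiltProp7CovAgmonWindow
import HarnessLib

/-!
# Route `UnitScaleTilt`, crux K1 «MinimiserStabilityRegPr» (stmt-QuantumFields-19200), route-R E′ path (α′), (E1-b) at the CURVED background, P-cov2 row (A-door-cov), part 3:
# THE COVARIANT DOOR UNDER THE NUMERIC WINDOW — `Σ_z √hs(Δ_U(V − U_int)(z)) ≤ W·(3N_h + 5√A·N_ht + 5A·N_s) + N₂ + N₃ + W·3N₄` (and the TYPE-1 form `W·3N_h + N₂ + N₃ + W·3N₄`)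
# under px4 g3's ★★★ `Prop7CovAgmonWindow.weighted_covLaplace_le_window` (windows `a ≤ 1∕2`, `a√d√A ≤ 1∕100`, `b·d·A ≤ 1∕50`) — the EXACT covariant twin of the flat door ✓p663210
# `Prop7PinnedKernelL1OfRows.sum_abs_laplace_sub_interp_le_of_rows`, constants and windows identical, which is the form the (A-cov) instantiation reads at `κ₀` as (F-a)∕(F-b) did

Cell `ym3-torus`, width seat `ym3-torus-px22` (gen 2), on ★routeR-w3 g6's word «px22 g2: (A-door-cov)» (21:47:43Z); companion of ✓p673628 (core constants `p γ A′ g₁ τ`, windows `H1 H2`).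
`--supports stmt-QuantumFields-19200`, count-neutral.  THEOREMS ONLY (0 `def`, 0 `sorry`).  YM₃ on T³ is a ladder rung (R3), not the Clay problem; nothing here claims the stub, the crux,
d = 4 or the gap.

WHAT IS PROVED (ns `…Theorems.Prop7CovPinnedKernelL1OfRowsWindow`; letters of ✓p672563∕✓p673628).
* ★★★ `sum_sqrt_hs_covLaplace_sub_interp_le_of_rows_window` — general sources `h ht s` of the free far field `(1−χ)•V` (one identity `hELF`).
* ★★★ `sum_sqrt_hs_covLaplace_sub_interp_le_type_one_window` — the TYPE-1 door (compactly supported transplant, routeR-w6 g6 LOCATE-PCOV2 §5 (a)).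
HONEST SCOPE.  Assembly only (two calls of px4 g3's window + ✓p672563's bookkeeping door); no kernel estimate, no frame; (N-cov) is LOCATE-PCOV2 §5.

References: T. Bałaban, CMP 99 (1985) 389–434 [Balaban1985BackgroundPropagators] ((3.8) p.392); CMP 96 (1984) 223–250 [Balaban1984PropagatorsII] ((1.9) p.226);
CMP 99 (1985) 75–102 [Balaban1985RegularSpaces] ((1.36) p.82); CMP 102 (1985) 277–309 [Balaban1985Variational] (Prop. 7 p.299).
-/

set_option autoImplicit false

noncomputable section

open scoped BigOperators Matrix

namespace Summit.QuantumFields.YangMills.Theorems.Prop7CovPinnedKernelL1OfRowsWindow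

open Literature.MathematicalPhysics.QuantumFieldTheory.Balaban1983to89
open B9Eq39Adjoint (R R_def covD covDstar divB)
open B9TorusCalculus (torusT torusT_apply torusT_symm_apply)
open Summit.QuantumFields.YangMills.Theorems.Prop7CovAgmonWindow (weighted_covLaplace_le_window)
open Summit.QuantumFields.YangMills.Theorems.Prop7CovPinnedKernelL1OfRows (far_vanishes_on far_el_of_sources el_type_one
  sum_sqrt_hs_covLaplace_sub_interp_le_of_far_rows)
open Summit.QuantumFields.YangMills.Theorems.Prop7CovPinnedKernelL1OfRowsCore (sum_hs_zero interp_el_type_one)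

variable {P : Params} {i : ℕ} {N : ℕ}
variable {U : Fin P.d → Site P i → (Matrix (Fin N) (Fin N) ℂ)ˣ}

/-- ★★★ **THE COVARIANT DOOR UNDER THE NUMERIC WINDOW** (general sources): DATA as in ✓ `Prop7CovPinnedKernelL1OfRowsCore.sum_sqrt_hs_covLaplace_sub_interp_le_of_rows_cov`, with the
core's letters∕windows replaced by px4 g3's `ha : a ≤ 1∕2`, `hwin₁ : a√d√A ≤ 1∕100`, `hwin₂ : b·d·A ≤ 1∕50`.  THEN
`Σ_z √hs(Δ_U(V − U_int) z) ≤ W·(3N_h + 5√A·N_ht + 5A·N_s) + N₂ + N₃ + W·(3N₄)` — the flat ✓p663210 verbatim in `hs` letters.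
[cite: Balaban1984PropagatorsII, (1.9) p.226; Balaban1985RegularSpaces, (1.36) p.82; Balaban1985BackgroundPropagators, (3.8) p.392; Balaban1985Variational, Prop. 7 p.299] -/
theorem sum_sqrt_hs_covLaplace_sub_interp_le_of_rows_window (hU : ∀ ν x, (U ν x : Matrix (Fin N) (Fin N) ℂ) ∈ unitary (Matrix (Fin N) (Fin N) ℂ))
    (C : Set (Site P i)) (χ ω : Site P i → ℝ) (V Ui u U₂ h s : Site P i → Matrix (Fin N) (Fin N) ℂ) (ht : Fin P.d → Site P i → Matrix (Fin N) (Fin N) ℂ)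
    {a b A W Nh Nht Ns N₂ N₃ N₄ : ℝ} (ha0 : 0 ≤ a) (hb0 : 0 ≤ b) (hA : 0 ≤ A)
    -- the objects
    (hUC : ∀ x ∈ C, Ui x = V x)
    (hUel : ∀ x ∉ C, divB (torusT P i) U (fun μ => covD (torusT P i) U μ
      (fun y => divB (torusT P i) U (fun ν => covD (torusT P i) U ν Ui) y)) x = 0)
    (hu : ∀ x ∈ C, u x = χ x • V x)
    (hU₂C : ∀ x ∈ C, U₂ x = u x)
    (hU₂el : ∀ x ∉ C, divB (torusT P i) U (fun μ => covD (torusT P i) U μ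
      (fun y => divB (torusT P i) U (fun ν => covD (torusT P i) U ν U₂) y)) x = 0)
    (hELF : ∀ v : Site P i → Matrix (Fin N) (Fin N) ℂ, (∀ y ∈ C, v y = 0) →
      ∑ x, (((divB (torusT P i) U (fun μ => covD (torusT P i) U μ (fun y => (1 - χ y) • V y)) x)ᴴ
          * divB (torusT P i) U (fun μ => covD (torusT P i) U μ v) x).trace).re
        = ∑ x, (((h x)ᴴ * divB (torusT P i) U (fun μ => covD (torusT P i) U μ v) x).trace).re
          + ∑ x, ∑ μ, (((ht μ x)ᴴ * covD (torusT P i) U μ v x).trace).re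
          + ∑ x, (((s x)ᴴ * v x).trace).re)
    -- the weight, the Poincaré row, the numeric window (px4 g3's letters verbatim)
    (hω₀ : ∀ x, 0 < ω x)
    (hω₁ : ∀ x μ, |ω (x.shift μ) - ω x| ≤ a * ω x ∧ |ω (x.unshift μ) - ω x| ≤ a * ω x)
    (hω₂ : ∀ x μ, |ω (x.shift μ) + ω (x.unshift μ) - 2 * ω x| ≤ b * ω x)
    (hP : ∀ v : Site P i → Matrix (Fin N) (Fin N) ℂ, (∀ y ∈ C, v y = 0) →
      Real.sqrt (∑ x, ∑ j : Fin N, ∑ k : Fin N, ‖(v x) j k‖ ^ 2)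
        ≤ A * Real.sqrt (∑ x, ∑ j : Fin N, ∑ k : Fin N, ‖(divB (torusT P i) U (fun μ => covD (torusT P i) U μ v) x) j k‖ ^ 2))
    (ha : a ≤ 1 / 2) (hwin₁ : a * Real.sqrt P.d * Real.sqrt A ≤ 1 / 100) (hwin₂ : b * P.d * A ≤ 1 / 50)
    -- the seven numbers
    (hNh : Real.sqrt (∑ x, ω x ^ 2 * ∑ j : Fin N, ∑ k : Fin N, ‖(h x) j k‖ ^ 2) ≤ Nh)
    (hNht : Real.sqrt (∑ x, ∑ μ, ω x ^ 2 * ∑ j : Fin N, ∑ k : Fin N, ‖(ht μ x) j k‖ ^ 2) ≤ Nht)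
    (hNs : Real.sqrt (∑ x, ω x ^ 2 * ∑ j : Fin N, ∑ k : Fin N, ‖(s x) j k‖ ^ 2) ≤ Ns)
    (hW : Real.sqrt (∑ z, (ω z)⁻¹ ^ 2) ≤ W)
    (hN₂ : ∑ z, Real.sqrt (∑ j : Fin N, ∑ k : Fin N, ‖(divB (torusT P i) U (fun μ => covD (torusT P i) U μ (fun y => χ y • V y)) z) j k‖ ^ 2) ≤ N₂)
    (hN₃ : ∑ z, Real.sqrt (∑ j : Fin N, ∑ k : Fin N, ‖(divB (torusT P i) U (fun μ => covD (torusT P i) U μ u) z) j k‖ ^ 2) ≤ N₃)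
    (hN₄ : Real.sqrt (∑ x, ω x ^ 2 * ∑ j : Fin N, ∑ k : Fin N, ‖(divB (torusT P i) U (fun μ => covD (torusT P i) U μ u) x) j k‖ ^ 2) ≤ N₄) :
    ∑ z, Real.sqrt (∑ j : Fin N, ∑ k : Fin N, ‖(divB (torusT P i) U (fun μ => covD (torusT P i) U μ (fun y => V y - Ui y)) z) j k‖ ^ 2)
      ≤ W * (3 * Nh + 5 * Real.sqrt A * Nht + 5 * A * Ns) + N₂ + N₃ + W * (3 * N₄) := by
  -- (T1): the far bracket through the window
  have he₁ := far_vanishes_on C χ V Ui u U₂ hUC hu hU₂C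
  have hEL₁ := far_el_of_sources hU C χ V Ui U₂ h s ht hUel hU₂el hELF
  have hwin1 := (weighted_covLaplace_le_window hU C ω (fun x => (1 - χ x) • V x - (Ui x - U₂ x)) h s ht ha0 hb0 hA hω₀ hω₁ hω₂ hP
    he₁ hEL₁ ha hwin₁ hwin₂).1
  have hB₁ : Real.sqrt (∑ x, ω x ^ 2 * ∑ j : Fin N, ∑ k : Fin N,
      ‖(divB (torusT P i) U (fun μ => covD (torusT P i) U μ (fun y => (1 - χ y) • V y - (Ui y - U₂ y))) x) j k‖ ^ 2)
        ≤ 3 * Nh + 5 * Real.sqrt A * Nht + 5 * A * Ns := by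
    refine hwin1.trans ?_
    have h2 : 0 ≤ 5 * Real.sqrt A := by positivity
    have h3 : 0 ≤ 5 * A := by positivity
    nlinarith [mul_le_mul_of_nonneg_left hNht h2, mul_le_mul_of_nonneg_left hNs h3, hNh]
  -- (T4): the near interpolation error, type-1
  have he₄ : ∀ y ∈ C, (fun x => u x - U₂ x) y = 0 := fun y hy => by simp [hU₂C y hy]
  have hEL₄ := interp_el_type_one hU C u U₂ hU₂el
  have hwin4 := (weighted_covLaplace_le_window hU C ω (fun x => u x - U₂ x)
    (fun x => divB (torusT P i) U (fun μ => covD (torusT P i) U μ u) x) (fun _ => 0) (fun _ _ => 0) ha0 hb0 hA hω₀ hω₁ hω₂ hP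
    he₄ hEL₄ ha hwin₁ hwin₂).1
  obtain ⟨hz1, hz2⟩ := sum_hs_zero (P := P) (i := i) (N := N) ω
  have hB₄ : Real.sqrt (∑ x, ω x ^ 2 * ∑ j : Fin N, ∑ k : Fin N,
      ‖(divB (torusT P i) U (fun μ => covD (torusT P i) U μ (fun y => u y - U₂ y)) x) j k‖ ^ 2) ≤ 3 * N₄ := by
    refine hwin4.trans ?_
    simp only [hz1, hz2, Real.sqrt_zero, mul_zero, add_zero]
    linarith
  exact sum_sqrt_hs_covLaplace_sub_interp_le_of_far_rows χ V Ui u U₂ ω hω₀ hW hB₁ hN₂ hN₃ hB₄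

/-- ★★★ **THE TYPE-1 COVARIANT DOOR UNDER THE NUMERIC WINDOW**: no sources; `√Σω²hs(Δ_U((1−χ)•V)) ≤ N_h` ⇒ `Σ_z √hs(Δ_U(V − U_int) z) ≤ W·(3N_h) + N₂ + N₃ + W·(3N₄)`.
[cite: Balaban1984PropagatorsII, (1.9) p.226; Balaban1985RegularSpaces, (1.36) p.82; Balaban1985BackgroundPropagators, (3.8) p.392] -/
theorem sum_sqrt_hs_covLaplace_sub_interp_le_type_one_window (hU : ∀ ν x, (U ν x : Matrix (Fin N) (Fin N) ℂ) ∈ unitary (Matrix (Fin N) (Fin N) ℂ))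
    (C : Set (Site P i)) (χ ω : Site P i → ℝ) (V Ui u U₂ : Site P i → Matrix (Fin N) (Fin N) ℂ)
    {a b A W Nh N₂ N₃ N₄ : ℝ} (ha0 : 0 ≤ a) (hb0 : 0 ≤ b) (hA : 0 ≤ A)
    (hUC : ∀ x ∈ C, Ui x = V x)
    (hUel : ∀ x ∉ C, divB (torusT P i) U (fun μ => covD (torusT P i) U μ
      (fun y => divB (torusT P i) U (fun ν => covD (torusT P i) U ν Ui) y)) x = 0)
    (hu : ∀ x ∈ C, u x = χ x • V x)
    (hU₂C : ∀ x ∈ C, U₂ x = u x)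
    (hU₂el : ∀ x ∉ C, divB (torusT P i) U (fun μ => covD (torusT P i) U μ
      (fun y => divB (torusT P i) U (fun ν => covD (torusT P i) U ν U₂) y)) x = 0)
    (hω₀ : ∀ x, 0 < ω x)
    (hω₁ : ∀ x μ, |ω (x.shift μ) - ω x| ≤ a * ω x ∧ |ω (x.unshift μ) - ω x| ≤ a * ω x)
    (hω₂ : ∀ x μ, |ω (x.shift μ) + ω (x.unshift μ) - 2 * ω x| ≤ b * ω x)
    (hP : ∀ v : Site P i → Matrix (Fin N) (Fin N) ℂ, (∀ y ∈ C, v y = 0) →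
      Real.sqrt (∑ x, ∑ j : Fin N, ∑ k : Fin N, ‖(v x) j k‖ ^ 2)
        ≤ A * Real.sqrt (∑ x, ∑ j : Fin N, ∑ k : Fin N, ‖(divB (torusT P i) U (fun μ => covD (torusT P i) U μ v) x) j k‖ ^ 2))
    (ha : a ≤ 1 / 2) (hwin₁ : a * Real.sqrt P.d * Real.sqrt A ≤ 1 / 100) (hwin₂ : b * P.d * A ≤ 1 / 50)
    (hNh : Real.sqrt (∑ x, ω x ^ 2 * ∑ j : Fin N, ∑ k : Fin N,
      ‖(divB (torusT P i) U (fun μ => covD (torusT P i) U μ (fun y => (1 - χ y) • V y)) x) j k‖ ^ 2) ≤ Nh)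
    (hW : Real.sqrt (∑ z, (ω z)⁻¹ ^ 2) ≤ W)
    (hN₂ : ∑ z, Real.sqrt (∑ j : Fin N, ∑ k : Fin N, ‖(divB (torusT P i) U (fun μ => covD (torusT P i) U μ (fun y => χ y • V y)) z) j k‖ ^ 2) ≤ N₂)
    (hN₃ : ∑ z, Real.sqrt (∑ j : Fin N, ∑ k : Fin N, ‖(divB (torusT P i) U (fun μ => covD (torusT P i) U μ u) z) j k‖ ^ 2) ≤ N₃)
    (hN₄ : Real.sqrt (∑ x, ω x ^ 2 * ∑ j : Fin N, ∑ k : Fin N, ‖(divB (torusT P i) U (fun μ => covD (torusT P i) U μ u) x) j k‖ ^ 2) ≤ N₄) :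
    ∑ z, Real.sqrt (∑ j : Fin N, ∑ k : Fin N, ‖(divB (torusT P i) U (fun μ => covD (torusT P i) U μ (fun y => V y - Ui y)) z) j k‖ ^ 2)
      ≤ W * (3 * Nh) + N₂ + N₃ + W * (3 * N₄) := by
  obtain ⟨hz1, hz2⟩ := sum_hs_zero (P := P) (i := i) (N := N) ω
  have h := sum_sqrt_hs_covLaplace_sub_interp_le_of_rows_window hU C χ ω V Ui u U₂
    (fun x => divB (torusT P i) U (fun μ => covD (torusT P i) U μ (fun y => (1 - χ y) • V y)) x) (fun _ => 0) (fun _ _ => 0)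
    (Nht := 0) (Ns := 0) ha0 hb0 hA hUC hUel hu hU₂C hU₂el (el_type_one C χ V) hω₀ hω₁ hω₂ hP ha hwin₁ hwin₂ hNh
    (by rw [hz2, Real.sqrt_zero]) (by rw [hz1, Real.sqrt_zero]) hW hN₂ hN₃ hN₄
  simpa only [mul_zero, add_zero] using h

end Summit.QuantumFields.YangMills.Theorems.Prop7CovPinnedKernelL1OfRowsWindow

end
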